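import Literature.NumberTheory.DiophantineGeometry.AbcValuationProductFreyDataProofs
import Literature.NumberTheory.DiophantineGeometry.AbcTwoAdicValuationProofs
import Literature.NumberTheory.DiophantineGeometry.PastenValuationProductsAdmissible
import Literature.NumberTheory.EllipticCurves.PastenCor162FromThm161Proofs
import Literature.NumberTheory.DiophantineGeometry.AbcDivisorBoundLinearForms
import HarnessLib

/-!
# Pasten's `abc` bound `d(abc) ≪_ε rad(abc)^{8/3+ε}` (arXiv Thm 16.7 = JNT Thm 16.8 =
# `pasten2024_thm_2_5`) from Theorem 16.4 (ii): the printed proof of §16.4, kernel-checked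

A *proofs* file (theorems only: no definition, no named fact) for the named fact
`Literature.NumberTheory.DiophantineGeometry.pasten2024_thm_2_5` (`AbcValuationProduct.lean`):
H. Pasten, *Shimura curves and the abc conjecture*, J. Number Theory **254** (2024) 214–335 =
arXiv:1705.09251v4, §16.4 "Products of valuations of `abc` triples", Theorem 16.7 (p. 51; = Thm
16.8 / Thm 1.10 of the journal numbering; = Thm 2.5 of Pasten, Invent. Math. 236 (2024)): "for all
coprime positive integers `a + b = c`, `d(abc) < K_ε · rad(abc)^{8/3+ε}`".

Inputs of the printed proof (p. 51): (1) Proposition 15.1 (tree fact `pastenShimura2024_prop_15_1`)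
for the triples with `ω(abc) ≤ ν`; (2) Lemma 15.2, `v₂(abc) ≪_ε rad(abc)^ε` — hypothesis `h152`
of `pasten2024_thm_2_5_of_thm_16_4_of_twoAdicBound`, PROVED from the `p`-adic place bounds (hence
from `PastenApproximationBound K`) in `AbcTwoAdicValuationProofs.lean`; (3) the Frey–Hellegouarch curve
`E : y² = x(x−a)(x+b)` with `v_p(N) = 1`, `v_p(Δ) = 2 v_p(abc)` at odd `p ∣ abc`, `N = 2^r p₁⋯p_m` —
`AbcValuationProductFreyDataProofs.lean`; (4) **Theorem 16.4 (ii)** for `E` (hypothesis `h164`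
below, spelled as case (ii) of the typed fact `pastenShimura2024_thm_16_4` of
`PastenValuationProductsAdmissible.lean`, projection `.freyHellegouarch`) at the admissible
`D = p₁⋯p_m/(p_{j₁}p_{j₂}p_{j₃})`, `M = 2^r p_{j₁}p_{j₂}p_{j₃}` with `(m−3)`-rd roots (`m` odd).
Result: the core `card_divisors_lt_of_thm_16_4_core` (inputs: a small-`ω` divisor bound, a
`2`-part bound carrying an extra exponent `θ`, and (4); conclusion `d(abc) < K rad^{8/3+θ+ε}`),
`pasten2024_thm_2_5_of_thm_16_4_of_twoAdicBound` (inputs (1), (2), (4) as binders; `θ = 0`),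
`card_divisors_lt_of_thm_16_4_of_logBound` (the `2`-part from a polynomial bound `log c ≪ rad^θ`
only: `d(abc) ≪ rad^{8/3+θ+ε}`), `pasten2024_thm_2_5_of_thm_16_4` (input (2) from
`PastenApproximationBound K`) and, with the tree's trust base,
`pasten2024_thm_2_5_of_thm_16_4_of_evertseGyory`: the `abc` rung follows from
{Theorem 16.4 (ii), Proposition 15.1, Evertse–Győry 4.2.1}; the sequel
`AbcDivisorBoundLinearFormsProofs.lean` proves Proposition 15.1 as well and records the rung from
{Theorem 16.4 (ii), the two `p`-adic place bounds} (`pasten2024_thm_2_5_of_thm_16_4_of_placeBounds`).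

**One deviation from print, forced by the printed hypotheses of Theorem 16.4** (reading note of the
typing seat lit-abc-pasten, 2026-08-26/27): for `m` even the printed proof takes `D = p₁⋯p_m`,
`M = 2^r`; when `r ≥ 1` (`2 ∣ N`) this `M` is neither "not a prime" with `E` semi-stable (case (i):
`E` is not semi-stable for `r ≥ 2`, and `M = 2` is prime for `r = 1`) nor "divisible by at least
two odd primes" (case (ii)). The kernel proof uses case (ii) throughout: PAIRS
`M = 2^r p_{j₁}p_{j₂}` with `(m−2)`-nd roots for `m` even, the printed TRIPLES for `m` odd; the
bookkeeping `((8/3+ε')m + k)/(m−k) + O(1/m) → 8/3+ε'` (`k = 2, 3`) is the printed one, and the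
theorem stands as printed. Routine deviations: "`N ≫_ε 1`" is met by `ν ≥ N₀(ε')` (`N ≥ 2^m > m`),
`r ≤ 9` (from `N ∣ 2⁸ rad`) replaces `r ≤ 8`, and all `k`-subsets replace the cyclic ones.

## References

* [PastenShimura2024] H. Pasten, J. Number Theory 254 (2024) = arXiv:1705.09251v4 — §15 p. 47,
  §16.2 Thm 16.4 (p. 50), §16.4 Thm 16.7 with proof (p. 51).
* [Pasten2024] H. Pasten, Invent. Math. 236 (2024) 373–385 — Thm 2.1, Thm 2.5.
* [EvertseGyory2015] J.-H. Evertse, K. Győry, CUP 2015 — Thm 4.2.1.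
-/

noncomputable section

open Finset Real

namespace Literature.NumberTheory.DiophantineGeometry

open Literature.NumberTheory.Automorphic (IsAdmissibleFactorization IsFreyHellegouarch)
open Literature.NumberTheory.EllipticCurves (freyCurve pasten_cor_16_2.prod_admissible)

/-! ### Theorem 16.7: one triple with many prime factors -/

section Thm167

open Literature.NumberTheory.DiophantineGeometry.Dioph (PastenApproximationBound pastenK
  one_le_pastenK pasten2024_thm_2_1 evertseGyory_thm_4_2_1_rat)
open Literature.Barriers.ABC (one_le_rad_real)

variable {a b c : ℕ}

/-- The exponent bookkeeping of the printed proof ("for `ν` large in terms of `ε`"): with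
`ε' = ε/4`, `k ∈ {2, 3}` and `m ≥ 44/ε + 7`, `(m(8/3+ε') + k) ≤ (m−k)(8/3+ε/2)` and `m ≤ 3(m−k)`.
[cite: PastenShimura2024, Theorem 16.7 (proof, arXiv:1705.09251v4 p. 51)] -/
private theorem exponent_bookkeeping {ε : ℝ} (hε : 0 < ε) {m k : ℕ} (hk : k = 2 ∨ k = 3)
    (hm : 44 / ε + 7 ≤ (m : ℝ)) :
    (m : ℝ) * (8 / 3 + ε / 4) + k ≤ ((m : ℝ) - k) * (8 / 3 + ε / 2) ∧
      (m : ℝ) ≤ 3 * ((m : ℝ) - k) ∧ k < m := by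
  have hmε : 44 + 7 * ε ≤ (m : ℝ) * ε := by
    have := mul_le_mul_of_nonneg_right hm hε.le
    rwa [add_mul, div_mul_cancel₀ _ hε.ne'] at this
  have h7 : (7 : ℝ) ≤ m := le_trans (by linarith [show (0:ℝ) < 44 / ε by positivity]) hm
  have h7' : 7 ≤ m := by exact_mod_cast h7
  rcases hk with rfl | rfl
  · refine ⟨?_, ?_, by omega⟩
    · push_cast; nlinarith
    · push_cast; linarith
  · refine ⟨?_, ?_, by omega⟩
    · push_cast; nlinarith
    · push_cast; linarith

/-- `d(n) ≤ (v₂(n) + 1) · ∏_{q ∣ n, q odd} 2 v_q(n)` (`n ≠ 0`): `d(n) = ∏_{p ∣ n}(v_p(n) + 1)` and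
`v + 1 ≤ 2v` for `v ≥ 1` — the step "`∏_{p ∣ abc, p ≠ 2}(v_p(abc)+1) ≤ ∏_j 2 v_{p_j}(abc)`" of the
printed proof. [cite: PastenShimura2024, Theorem 16.7 (proof, arXiv:1705.09251v4 p. 51)] -/
private theorem card_divisors_le_mul_prod_erase {n : ℕ} (hn : n ≠ 0) :
    n.divisors.card ≤ (n.factorization 2 + 1) * ∏ q ∈ n.primeFactors.erase 2, 2 * n.factorization q := by
  rw [Nat.card_divisors hn]
  have hodd : ∏ q ∈ n.primeFactors.erase 2, (n.factorization q + 1) ≤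
      ∏ q ∈ n.primeFactors.erase 2, 2 * n.factorization q := by
    refine prod_le_prod' fun q hq => ?_
    have h1 : 1 ≤ n.factorization q := by
      rw [Nat.succ_le_iff, pos_iff_ne_zero, ← Finsupp.mem_support_iff, Nat.support_factorization]
      exact mem_of_mem_erase hq
    omega
  by_cases h2 : 2 ∈ n.primeFactors
  · rw [← mul_prod_erase _ _ h2]
    exact Nat.mul_le_mul_left _ hodd
  · have h0 : n.factorization 2 = 0 := by
      rw [← Finsupp.notMem_support_iff, Nat.support_factorization]; exact h2
    have hP : n.primeFactors.erase 2 = n.primeFactors := erase_eq_of_notMem h2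
    rw [h0, zero_add, one_mul]
    calc ∏ x ∈ n.primeFactors, (n.factorization x + 1)
        = ∏ q ∈ n.primeFactors.erase 2, (n.factorization q + 1) := by rw [hP]
      _ ≤ _ := hodd

/-- **The core of the printed proof of Theorem 16.7 for ONE triple with `m = #{q ∣ abc odd} > k`**:
if Theorem 16.4 holds at the Frey curve `E = E_{a,b}` with exponent `e ≥ 0` for every admissible
`N_E = DM` with `M` divisible by two odd primes (hypothesis `H`), then taking `D = ∏_{q ∈ P∖T} q`,
`M = N/D = 2^r ∏_{q ∈ T} q` over all `k`-subsets `T` of the odd primes `P` of `abc` (`m − k` even,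
`k ≥ 2`) and the `(m−k)`-th root gives `∏_{q ∈ P} v_q(Δ_E) < 2^{27} N_E^x` whenever
`m e + k ≤ (m−k) x` and `m ≤ 3(m−k)` (`r ≤ 9` enters as `M ≤ 2^9 ∏_T q`).
[cite: PastenShimura2024, Theorem 16.7 (proof, arXiv:1705.09251v4 p. 51)] -/
theorem prod_factorization_lt_of_thm_16_4_at (h : IsABCTriple a b c) {e x : ℝ} {k : ℕ}
    (hk2 : 2 ≤ k) (hkm : k < ((a * b * c).primeFactors.erase 2).card)
    (heven : Even (((a * b * c).primeFactors.erase 2).card - k))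
    (hkey : ((((a * b * c).primeFactors.erase 2).card : ℕ) : ℝ) * e + k ≤
      (((((a * b * c).primeFactors.erase 2).card : ℕ) : ℝ) - k) * x)
    (hkey2 : ((((a * b * c).primeFactors.erase 2).card : ℕ) : ℝ) ≤
      3 * (((((a * b * c).primeFactors.erase 2).card : ℕ) : ℝ) - k))
    (H : ∀ D M : ℕ, IsAdmissibleFactorization ((freyCurve (a : ℤ) (b : ℤ)).conductorNorm ℤ) D M →
      2 ≤ (M.primeFactors.erase 2).card →
        ((∏ p ∈ D.primeFactors,
            ((freyCurve (a : ℤ) (b : ℤ)).minimalDiscriminantNorm ℤ).factorization p : ℕ) : ℝ) <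
          (((freyCurve (a : ℤ) (b : ℤ)).conductorNorm ℤ : ℕ) : ℝ) ^ e * (M : ℝ)) :
    ((∏ q ∈ (a * b * c).primeFactors.erase 2,
        ((freyCurve (a : ℤ) (b : ℤ)).minimalDiscriminantNorm ℤ).factorization q : ℕ) : ℝ) <
      2 ^ 27 * (((freyCurve (a : ℤ) (b : ℤ)).conductorNorm ℤ : ℕ) : ℝ) ^ x := by
  haveI := h.freyCurve_isElliptic
  set W := freyCurve (a : ℤ) (b : ℤ) with hWdef
  set N : ℕ := W.conductorNorm ℤ with hNdef
  set Δ : ℕ := W.minimalDiscriminantNorm ℤ with hΔdef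
  set P : Finset ℕ := (a * b * c).primeFactors.erase 2 with hPdef
  set v : ℕ → ℕ := fun q => Δ.factorization q with hvdef
  set m : ℕ := P.card with hmdef
  have hNpos : 0 < N := W.conductorNorm_pos_holds
  have hNpos' : (0 : ℝ) < (N : ℝ) := by exact_mod_cast hNpos
  have hN1 : (1 : ℝ) ≤ (N : ℝ) := by exact_mod_cast hNpos
  have hPsub := h.erase_two_subset_filter
  have hPprime : ∀ q ∈ P, q.Prime := fun q hq => Nat.prime_of_mem_primeFactors (mem_of_mem_erase hq)
  have hPmem : ∀ q ∈ P, q.Prime ∧ q ≠ 2 ∧ q ∣ a * b * c := fun q hq => by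
    have h' := hq
    rw [hPdef, mem_erase, Nat.mem_primeFactors] at h'
    exact ⟨h'.2.1, h'.1, h'.2.2.1⟩
  have hv : ∀ q ∈ P, 0 < v q := fun q hq => by
    obtain ⟨hqp, hq2, hqn⟩ := hPmem q hq
    show 0 < Δ.factorization q
    rw [hΔdef, h.factorization_minimalDiscriminantNorm_freyCurve hqp hq2]
    have := Nat.Prime.factorization_pos_of_dvd hqp h.mul_ne_zero hqn
    omega
  -- `∏_P q ∣ N`
  obtain ⟨hPdvd, -, -, -⟩ := pasten_cor_16_2.prod_admissible hPsub
  have hk1 : 1 ≤ k := by omega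
  -- Step 1: the hypothesis of the root lemma, for every `k`-subset `T`.
  have hA : (0 : ℝ) < 2 ^ 9 * (N : ℝ) ^ e := by positivity
  have hT : ∀ T ∈ P.powersetCard k,
      ((∏ p ∈ P \ T, v p : ℕ) : ℝ) < 2 ^ 9 * (N : ℝ) ^ e * ((∏ p ∈ T, p : ℕ) : ℝ) := by
    intro T hTm
    have hTP : T ⊆ P := (mem_powersetCard.1 hTm).1
    have hTcard : T.card = k := (mem_powersetCard.1 hTm).2
    have hQ : P \ T ⊆ N.primeFactors.filter (fun p => ¬ p ^ 2 ∣ N) := (sdiff_subset).trans hPsub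
    obtain ⟨hDdvd, hcop, hsq, hpf⟩ := pasten_cor_16_2.prod_admissible hQ
    set D : ℕ := ∏ q ∈ P \ T, q with hDdef
    have hD0 : 0 < D := prod_pos fun q hq => (hPprime q (sdiff_subset hq)).pos
    have hcardQ : (P \ T).card = m - k := by rw [card_sdiff_of_subset hTP, hTcard]
    have hadm : IsAdmissibleFactorization N D (N / D) :=
      ⟨hNpos, Nat.mul_div_cancel' hDdvd, hsq, by rw [hpf, hcardQ]; exact heven, hcop⟩
    set M : ℕ := N / D with hMdef
    have hDM : D * M = N := Nat.mul_div_cancel' hDdvd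
    have hM0 : M ≠ 0 := fun h0 => by rw [h0, mul_zero] at hDM; exact hNpos.ne' hDM.symm
    -- `T ⊆` odd primes of `M`
    have hTM : T ⊆ M.primeFactors.erase 2 := by
      intro q hqT
      obtain ⟨hqp, hq2, hqn⟩ := hPmem q (hTP hqT)
      have hqN : q ∣ N := h.dvd_conductorNorm_freyCurve hqp hq2 hqn
      have hqD : ¬ q ∣ D := fun hqD => by
        have : q ∈ D.primeFactors := Nat.mem_primeFactors.2 ⟨hqp, hqD, hD0.ne'⟩
        rw [hpf, mem_sdiff] at this
        exact this.2 hqT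
      have hqM : q ∣ M := by
        rw [← hDM] at hqN
        exact ((Nat.Prime.dvd_mul hqp).1 hqN).resolve_left hqD
      exact mem_erase.2 ⟨hq2, Nat.mem_primeFactors.2 ⟨hqp, hqM, hM0⟩⟩
    have hM2 : 2 ≤ (M.primeFactors.erase 2).card :=
      hk2.trans (hTcard ▸ card_le_card hTM)
    -- Theorem 16.4 (ii) at `(D, M)`
    have h164 := H D M hadm hM2
    rw [hpf] at h164
    -- `M ≤ 2^9 ∏_T q`
    have hMle : (M : ℝ) ≤ 2 ^ 9 * ((∏ p ∈ T, p : ℕ) : ℝ) := by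
      have h1 : N ∣ 2 ^ 9 * ∏ q ∈ P, q := h.conductorNorm_freyCurve_dvd_prod_erase
      rw [← prod_sdiff hTP, ← hDM, ← hDdef, mul_left_comm] at h1
      have h2 : M ∣ 2 ^ 9 * ∏ q ∈ T, q := Nat.dvd_of_mul_dvd_mul_left hD0 h1
      have h3 : M ≤ 2 ^ 9 * ∏ q ∈ T, q :=
        Nat.le_of_dvd (by positivity [prod_pos fun q hq => (hPprime q (hTP hq)).pos]) h2
      exact_mod_cast h3
    calc ((∏ p ∈ P \ T, v p : ℕ) : ℝ) < (N : ℝ) ^ e * (M : ℝ) := h164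
      _ ≤ (N : ℝ) ^ e * (2 ^ 9 * ((∏ p ∈ T, p : ℕ) : ℝ)) :=
          mul_le_mul_of_nonneg_left hMle (by positivity)
      _ = 2 ^ 9 * (N : ℝ) ^ e * ((∏ p ∈ T, p : ℕ) : ℝ) := by ring
  -- Step 2: the root lemma and the bookkeeping.
  have hroot := sub_mul_log_prod_lt_of_forall_powersetCard hPprime hv hk1 hkm hA hT
  have hVpos : (0 : ℝ) < ((∏ p ∈ P, v p : ℕ) : ℝ) := by exact_mod_cast prod_pos fun p hp => hv p hp
  have hPprod_le : Real.log ((∏ p ∈ P, p : ℕ) : ℝ) ≤ Real.log N := by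
    have h0 : (0 : ℝ) < ((∏ p ∈ P, p : ℕ) : ℝ) := by exact_mod_cast prod_pos fun q hq => (hPprime q hq).pos
    exact Real.log_le_log h0 (by exact_mod_cast Nat.le_of_dvd hNpos hPdvd)
  have hlogA : Real.log (2 ^ 9 * (N : ℝ) ^ e) = 9 * Real.log 2 + e * Real.log N := by
    rw [Real.log_mul (by positivity) (by positivity), Real.log_pow, Real.log_rpow hNpos']; norm_num
  have hlogN : 0 ≤ Real.log (N : ℝ) := Real.log_nonneg hN1
  have hl2 : 0 < Real.log 2 := Real.log_pos (by norm_num)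
  have hmk : (0 : ℝ) < (m : ℝ) - k := by
    have : (k : ℝ) < m := by exact_mod_cast hkm
    linarith
  rw [hlogA] at hroot
  -- `(m-k) L < m (9 log 2 + e log N) + k log ∏ q ≤ (m - k)(27 log 2 + x log N)`
  have hmain : Real.log ((∏ p ∈ P, v p : ℕ) : ℝ) < 27 * Real.log 2 + x * Real.log N := by
    have h1 : ((m : ℝ) - k) * Real.log ((∏ p ∈ P, v p : ℕ) : ℝ) <
        ((m : ℝ) - k) * (27 * Real.log 2 + x * Real.log N) := by
      calc ((m : ℝ) - k) * Real.log ((∏ p ∈ P, v p : ℕ) : ℝ)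
          < m * (9 * Real.log 2 + e * Real.log N) + k * Real.log ((∏ p ∈ P, p : ℕ) : ℝ) := hroot
        _ ≤ m * (9 * Real.log 2 + e * Real.log N) + k * Real.log N := by
            have : (0 : ℝ) ≤ k := by positivity
            nlinarith
        _ = 9 * (m * Real.log 2) + ((m : ℝ) * e + k) * Real.log N := by ring
        _ ≤ 9 * (3 * ((m : ℝ) - k) * Real.log 2) + (((m : ℝ) - k) * x) * Real.log N := by
            apply add_le_add
            · nlinarith
            · exact mul_le_mul_of_nonneg_right hkey hlogN
        _ = ((m : ℝ) - k) * (27 * Real.log 2 + x * Real.log N) := by ring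
    exact lt_of_mul_lt_mul_left h1 hmk.le
  have hrhs : 27 * Real.log 2 + x * Real.log N = Real.log (2 ^ 27 * (N : ℝ) ^ x) := by
    rw [Real.log_mul (by positivity) (by positivity), Real.log_pow, Real.log_rpow hNpos']; norm_num
  rw [hrhs, Real.log_lt_log_iff hVpos (by positivity)] at hmain
  exact hmain

end Thm167

/-! ### Theorem 16.7 = `pasten2024_thm_2_5`: the assembly -/

section Assembly

open Literature.NumberTheory.DiophantineGeometry.Dioph (PastenApproximationBound pastenK
  one_le_pastenK pasten2024_thm_2_1 evertseGyory_thm_4_2_1_rat)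
open Literature.Barriers.ABC (one_le_rad_real)

/-- **The core of Theorem 16.7 with generic inputs** (for a fixed `ε > 0` and an extra exponent
`θ` carried by the `2`-part): if (small `ω`) for every `ν` the abc triples with `ω(abc) = ν`
satisfy `d(abc) ≤ K_ν rad^{8/3+θ+ε}`; (the `2`-part) `v₂(abc) + 1 ≤ C₂ rad^{θ+ε/4}`; and Theorem
16.4 (ii) holds with exponent `8/3 + ε/4` for the Frey–Hellegouarch curves of conductor `≥ N₀`,
then `d(abc) < K rad^{8/3+θ+ε}` for all abc triples. Proof = the printed proof of Thm 16.7 (p. 51)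
with the `m`-even step run on PAIRS (module docstring): `ν = max(N₀, ⌈44/ε⌉ + 7)`; `ω`-small
triples by the first hypothesis (summed over `ω ≤ ν+1`); otherwise
`d(abc) ≤ (v₂(abc)+1) ∏_{q odd} v_q(Δ_E) < C₂ rad^{θ+ε/4} · 2^{27} N_E^{8/3+ε/2}`
(`prod_factorization_lt_of_thm_16_4_at`) and `N_E ≤ 2⁸ rad(abc)`. In print `θ = 0`, the first input
is Proposition 15.1 and the second is Lemma 15.2.
[cite: PastenShimura2024, Theorem 16.7 with its proof (§16.4, arXiv:1705.09251v4 p. 51)] -/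
theorem card_divisors_lt_of_thm_16_4_core {ε θ : ℝ} (hε : 0 < ε)
    (hsmall : ∀ ν : ℕ, ∃ K : ℝ, 0 < K ∧ ∀ a b c : ℕ, IsABCTriple a b c →
      (a * b * c).primeFactors.card = ν →
        ((a * b * c).divisors.card : ℝ) ≤ K * (rad a b c : ℝ) ^ (8 / 3 + θ + ε))
    (htwo : ∃ C₂ : ℝ, 0 < C₂ ∧ ∀ a b c : ℕ, IsABCTriple a b c →
      (((a * b * c).factorization 2 : ℕ) : ℝ) + 1 ≤ C₂ * (rad a b c : ℝ) ^ (θ + ε / 4))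
    (h164 : ∃ N₀ : ℕ, ∀ (W : WeierstrassCurve ℚ) [W.IsElliptic],
      IsFreyHellegouarch W → N₀ ≤ W.conductorNorm ℤ →
        ∀ D M : ℕ, IsAdmissibleFactorization (W.conductorNorm ℤ) D M →
          2 ≤ (M.primeFactors.erase 2).card →
            ((∏ p ∈ D.primeFactors, (W.minimalDiscriminantNorm ℤ).factorization p : ℕ) : ℝ)
              < (W.conductorNorm ℤ : ℝ) ^ ((8 : ℝ) / 3 + ε / 4) * (M : ℝ)) :
    ∃ K : ℝ, 0 < K ∧ ∀ a b c : ℕ, IsABCTriple a b c →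
      ((a * b * c).divisors.card : ℝ) < K * (rad a b c : ℝ) ^ (8 / 3 + θ + ε) := by
  -- constants chosen before the triple
  obtain ⟨N₀, hN₀⟩ := h164
  obtain ⟨C₂, hC₂0, hC₂⟩ := htwo
  set ν : ℕ := max N₀ (⌈44 / ε⌉₊ + 7) with hνdef
  choose Kf hKf0 hKf using hsmall
  set Ks : ℝ := ∑ j ∈ Finset.range (ν + 2), Kf j with hKsdef
  have hKs0 : 0 ≤ Ks := sum_nonneg fun j _ => (hKf0 j).le
  set Cl : ℝ := C₂ * (2 ^ 27 * (2 ^ 8) ^ (8 / 3 + ε / 2 : ℝ)) with hCldef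
  have hCl0 : 0 < Cl := by positivity
  refine ⟨Ks + Cl + 1, by positivity, fun a b c h => ?_⟩
  have h0 := h.mul_ne_zero
  have hR1 : (1 : ℝ) ≤ (rad a b c : ℝ) := one_le_rad_real a b c
  have hR0 : (0 : ℝ) < (rad a b c : ℝ) := by positivity
  have hRpow : (0 : ℝ) < (rad a b c : ℝ) ^ (8 / 3 + θ + ε : ℝ) := by positivity
  by_cases hm : ((a * b * c).primeFactors.erase 2).card < ν
  · -- few prime factors: the small-`ω` input (Proposition 15.1 in print)
    have hj : (a * b * c).primeFactors.card < ν + 2 := by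
      have := pred_card_le_card_erase (s := (a * b * c).primeFactors) (a := 2)
      omega
    have hd := hKf _ a b c h rfl
    have hKj : Kf (a * b * c).primeFactors.card ≤ Ks :=
      single_le_sum (f := Kf) (fun i _ => (hKf0 i).le) (mem_range.2 hj)
    calc ((a * b * c).divisors.card : ℝ)
        ≤ Kf (a * b * c).primeFactors.card * (rad a b c : ℝ) ^ (8 / 3 + θ + ε) := hd
      _ ≤ Ks * (rad a b c : ℝ) ^ (8 / 3 + θ + ε : ℝ) := mul_le_mul_of_nonneg_right hKj hRpow.le
      _ < (Ks + Cl + 1) * (rad a b c : ℝ) ^ (8 / 3 + θ + ε : ℝ) := by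
          have := mul_pos hCl0 hRpow
          linarith
  · -- many prime factors: Theorem 16.4 (ii) on the Frey curve `y² = x(x-a)(x+b)`
    rw [not_lt] at hm
    haveI := h.freyCurve_isElliptic
    have hNpos : 0 < (freyCurve (a : ℤ) (b : ℤ)).conductorNorm ℤ :=
      (freyCurve (a : ℤ) (b : ℤ)).conductorNorm_pos_holds
    have hPprime : ∀ q ∈ (a * b * c).primeFactors.erase 2, q.Prime := fun q hq =>
      Nat.prime_of_mem_primeFactors (mem_of_mem_erase hq)
    -- `N ≥ N₀`: `N ≥ ∏_P q ≥ 2^m > m ≥ ν ≥ N₀`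
    obtain ⟨hPdvd, -, -, -⟩ := pasten_cor_16_2.prod_admissible h.erase_two_subset_filter
    have hN₀N : N₀ ≤ (freyCurve (a : ℤ) (b : ℤ)).conductorNorm ℤ := by
      have h1 : 2 ^ ((a * b * c).primeFactors.erase 2).card ≤ ∏ q ∈ (a * b * c).primeFactors.erase 2, q :=
        pow_card_le_prod _ (fun q => q) 2 fun q hq => (hPprime q hq).two_le
      have h2 := ((a * b * c).primeFactors.erase 2).card.lt_two_pow_self
      have h3 := Nat.le_of_dvd hNpos hPdvd
      have h4 : N₀ ≤ ν := le_max_left _ _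
      omega
    -- parity and bookkeeping
    have hmR : 44 / ε + 7 ≤ ((((a * b * c).primeFactors.erase 2).card : ℕ) : ℝ) := by
      have h1 : (44 / ε : ℝ) ≤ ⌈44 / ε⌉₊ := Nat.le_ceil _
      have h2 : ((⌈44 / ε⌉₊ + 7 : ℕ) : ℝ) ≤ ((a * b * c).primeFactors.erase 2).card := by
        exact_mod_cast (le_max_right _ _).trans hm
      push_cast at h2
      linarith
    obtain ⟨k, hk, hkeven⟩ : ∃ k : ℕ, (k = 2 ∨ k = 3) ∧
        Even (((a * b * c).primeFactors.erase 2).card - k) := by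
      rcases Nat.even_or_odd ((a * b * c).primeFactors.erase 2).card with ⟨t, ht⟩ | ⟨t, ht⟩
      · exact ⟨2, Or.inl rfl, ⟨t - 1, by omega⟩⟩
      · exact ⟨3, Or.inr rfl, ⟨t - 1, by omega⟩⟩
    obtain ⟨hkey, hkey2, hkm⟩ := exponent_bookkeeping hε hk hmR
    have hk2 : 2 ≤ k := by rcases hk with rfl | rfl <;> norm_num
    -- Theorem 16.4 (ii) at the Frey curve, exponent `8/3 + ε/4`
    have H : ∀ D M : ℕ, IsAdmissibleFactorization ((freyCurve (a : ℤ) (b : ℤ)).conductorNorm ℤ) D M →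
        2 ≤ (M.primeFactors.erase 2).card →
          ((∏ p ∈ D.primeFactors,
              ((freyCurve (a : ℤ) (b : ℤ)).minimalDiscriminantNorm ℤ).factorization p : ℕ) : ℝ) <
            (((freyCurve (a : ℤ) (b : ℤ)).conductorNorm ℤ : ℕ) : ℝ) ^ (8 / 3 + ε / 4 : ℝ) * (M : ℝ) :=
      fun D M hadm hM => hN₀ _ h.freyCurve_isFreyHellegouarch hN₀N D M hadm hM
    have hcore := prod_factorization_lt_of_thm_16_4_at h hk2 hkm hkeven hkey hkey2 H
    -- `d(abc) ≤ (v₂(abc) + 1) · ∏_{q odd} v_q(Δ)`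
    have hprodv : ∏ q ∈ (a * b * c).primeFactors.erase 2, 2 * (a * b * c).factorization q =
        ∏ q ∈ (a * b * c).primeFactors.erase 2,
          ((freyCurve (a : ℤ) (b : ℤ)).minimalDiscriminantNorm ℤ).factorization q :=
      prod_congr rfl fun q hq => by
        have h' := hq
        rw [mem_erase, Nat.mem_primeFactors] at h'
        rw [h.factorization_minimalDiscriminantNorm_freyCurve h'.2.1 h'.1]
    have hdnat := card_divisors_le_mul_prod_erase h0
    rw [hprodv] at hdnat
    have hd : ((a * b * c).divisors.card : ℝ) ≤
        (((a * b * c).factorization 2 + 1 : ℕ) : ℝ) *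
          ((∏ q ∈ (a * b * c).primeFactors.erase 2,
            ((freyCurve (a : ℤ) (b : ℤ)).minimalDiscriminantNorm ℤ).factorization q : ℕ) : ℝ) := by
      exact_mod_cast hdnat
    -- the `2`-part: `v₂(abc) + 1 ≤ C₂ rad^{θ+ε/4}` (Lemma 15.2 in print)
    have hv2 : (((a * b * c).factorization 2 + 1 : ℕ) : ℝ) ≤ C₂ * (rad a b c : ℝ) ^ (θ + ε / 4) := by
      have := hC₂ a b c h
      push_cast
      exact this
    -- `N^{8/3+ε/2} ≤ (2⁸)^{8/3+ε/2} rad^{8/3+ε/2}`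
    have hNpow : (((freyCurve (a : ℤ) (b : ℤ)).conductorNorm ℤ : ℕ) : ℝ) ^ (8 / 3 + ε / 2 : ℝ) ≤
        (2 ^ 8) ^ (8 / 3 + ε / 2 : ℝ) * (rad a b c : ℝ) ^ (8 / 3 + ε / 2 : ℝ) := by
      rw [← Real.mul_rpow (by positivity) hR0.le]
      exact Real.rpow_le_rpow (by positivity) h.conductorNorm_freyCurve_le (by positivity)
    have hRexp : (rad a b c : ℝ) ^ (θ + ε / 4) * (rad a b c : ℝ) ^ (8 / 3 + ε / 2 : ℝ) ≤
        (rad a b c : ℝ) ^ (8 / 3 + θ + ε : ℝ) := by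
      rw [← Real.rpow_add hR0]
      exact Real.rpow_le_rpow_of_exponent_le hR1 (by linarith)
    have hprod0 : (0 : ℝ) ≤ ((∏ q ∈ (a * b * c).primeFactors.erase 2,
        ((freyCurve (a : ℤ) (b : ℤ)).minimalDiscriminantNorm ℤ).factorization q : ℕ) : ℝ) := by
      positivity
    have hv20 : (0 : ℝ) ≤ C₂ * (rad a b c : ℝ) ^ (θ + ε / 4) := by positivity
    have hslack : (0 : ℝ) < (Ks + 1) * (rad a b c : ℝ) ^ (8 / 3 + θ + ε : ℝ) :=
      mul_pos (by positivity) hRpow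
    calc ((a * b * c).divisors.card : ℝ)
        ≤ (((a * b * c).factorization 2 + 1 : ℕ) : ℝ) *
          ((∏ q ∈ (a * b * c).primeFactors.erase 2,
            ((freyCurve (a : ℤ) (b : ℤ)).minimalDiscriminantNorm ℤ).factorization q : ℕ) : ℝ) := hd
      _ ≤ (C₂ * (rad a b c : ℝ) ^ (θ + ε / 4)) *
          (2 ^ 27 * (((freyCurve (a : ℤ) (b : ℤ)).conductorNorm ℤ : ℕ) : ℝ) ^ (8 / 3 + ε / 2 : ℝ)) :=
          mul_le_mul hv2 hcore.le hprod0 hv20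
      _ ≤ (C₂ * (rad a b c : ℝ) ^ (θ + ε / 4)) *
          (2 ^ 27 * ((2 ^ 8) ^ (8 / 3 + ε / 2 : ℝ) * (rad a b c : ℝ) ^ (8 / 3 + ε / 2 : ℝ))) :=
          mul_le_mul_of_nonneg_left (mul_le_mul_of_nonneg_left hNpow (by positivity)) hv20
      _ = Cl * ((rad a b c : ℝ) ^ (θ + ε / 4) * (rad a b c : ℝ) ^ (8 / 3 + ε / 2 : ℝ)) := by
          rw [hCldef]; ring
      _ ≤ Cl * (rad a b c : ℝ) ^ (8 / 3 + θ + ε : ℝ) := mul_le_mul_of_nonneg_left hRexp hCl0.le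
      _ < (Ks + Cl + 1) * (rad a b c : ℝ) ^ (8 / 3 + θ + ε : ℝ) := by linarith

/-- **Pasten, Theorem 16.7 (arXiv) = Theorem 16.8 / 1.10 (JNT 254) = `pasten2024_thm_2_5`, PROVED
from Theorem 16.4 (ii), Proposition 15.1 and Lemma 15.2.** Hypotheses: `h152` = the conclusion of
Lemma 15.2 (`v₂(abc) < C'_ε rad(abc)^ε`; proved from the `p`-adic place bounds / the approximation
bound in `AbcTwoAdicValuationProofs.lean`); the named fact `pastenShimura2024_prop_15_1`
(Proposition 15.1, used through its "in particular" clause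
`card_divisors_le_of_card_primeFactors_eq`: `d(abc) ≪_{ε,ν} rad^{1+ε}` for `ω(abc) = ν`); and
`h164` = Theorem 16.4 (ii) of arXiv:1705.09251v4 (p. 50) — for `ε > 0` there is `N₀` such that
every Frey–Hellegouarch `E/ℚ` with `N_E ≥ N₀` and every admissible `N_E = DM` with `M` divisible by
at least two odd primes satisfy `∏_{p ∣ D} v_p(Δ_E) < N_E^{8/3+ε} M` — spelled as case (ii) of the
typed fact `pastenShimura2024_thm_16_4` (`PastenValuationProductsAdmissible.lean`, projection
`.freyHellegouarch`). Conclusion: `pasten2024_thm_2_5` (through its divisor form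
`pasten2024_thm_2_5_of_card_divisors_lt` and the core `card_divisors_lt_of_thm_16_4_core` with
`θ = 0`). [cite: PastenShimura2024, Theorem 16.7 with its proof (§16.4, arXiv:1705.09251v4 p. 51)] -/
theorem pasten2024_thm_2_5_of_thm_16_4_of_twoAdicBound
    (h152 : ∀ ε : ℝ, 0 < ε → ∃ C : ℝ, 1 < C ∧ ∀ a b c : ℕ, IsABCTriple a b c →
      (((a * b * c).factorization 2 : ℕ) : ℝ) < C * (rad a b c : ℝ) ^ ε)
    (h151 : pastenShimura2024_prop_15_1)
    (h164 : ∀ ε : ℝ, 0 < ε → ∃ N₀ : ℕ, ∀ (W : WeierstrassCurve ℚ) [W.IsElliptic],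
      IsFreyHellegouarch W → N₀ ≤ W.conductorNorm ℤ →
        ∀ D M : ℕ, IsAdmissibleFactorization (W.conductorNorm ℤ) D M →
          2 ≤ (M.primeFactors.erase 2).card →
            ((∏ p ∈ D.primeFactors, (W.minimalDiscriminantNorm ℤ).factorization p : ℕ) : ℝ)
              < (W.conductorNorm ℤ : ℝ) ^ ((8 : ℝ) / 3 + ε) * (M : ℝ)) :
    pasten2024_thm_2_5 := by
  refine pasten2024_thm_2_5_of_card_divisors_lt fun ε hε => ?_
  have hsmall : ∀ ν : ℕ, ∃ K : ℝ, 0 < K ∧ ∀ a b c : ℕ, IsABCTriple a b c →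
      (a * b * c).primeFactors.card = ν →
        ((a * b * c).divisors.card : ℝ) ≤ K * (rad a b c : ℝ) ^ (8 / 3 + 0 + ε) := by
    intro ν
    obtain ⟨K, hK0, hK⟩ := h151.card_divisors_le_of_card_primeFactors_eq ε hε ν
    refine ⟨K, hK0, fun a b c h hν => (hK a b c h hν).trans ?_⟩
    exact mul_le_mul_of_nonneg_left
      (Real.rpow_le_rpow_of_exponent_le (one_le_rad_real a b c) (by linarith)) hK0.le
  have htwo : ∃ C₂ : ℝ, 0 < C₂ ∧ ∀ a b c : ℕ, IsABCTriple a b c →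
      (((a * b * c).factorization 2 : ℕ) : ℝ) + 1 ≤ C₂ * (rad a b c : ℝ) ^ ((0 : ℝ) + ε / 4) := by
    obtain ⟨C, hC1, hC⟩ := h152 (ε / 4) (by positivity)
    refine ⟨C + 1, by linarith, fun a b c h => ?_⟩
    have h1 := hC a b c h
    have hR : (1 : ℝ) ≤ (rad a b c : ℝ) ^ (ε / 4) := Real.one_le_rpow (one_le_rad_real a b c) (by positivity)
    rw [zero_add]
    nlinarith
  obtain ⟨K, hK0, hK⟩ :=
    card_divisors_lt_of_thm_16_4_core hε hsmall htwo (h164 (ε / 4) (by positivity))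
  exact ⟨K, hK0, fun a b c h => by simpa only [add_zero] using hK a b c h⟩

/-- **`d(abc) ≪ rad(abc)^{8/3+θ+ε}` from Theorem 16.4 (ii), a small-`ω` divisor bound and a
polynomial bound `log c ≪ rad(abc)^θ`** — the `2`-part being then trivial:
`v₂(abc) + 1 ≤ log₂(abc) + 1 ≤ (3κ/log 2 + 1) rad^θ`. With `θ = 2/3 + ε` (Stewart–Yu 1991, PROVED in
the tree for summit ABC as `stewartYu1991_holds`) and the small-`ω` bound from `p`-adic estimates of
Waldschmidt/Yu-1990 quality (sequel file), this gives `d(abc) ≪_ε rad(abc)^{10/3+ε}` from Theorem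
16.4 (ii) ALONE among unproved inputs. [cite: PastenShimura2024, Theorem 16.7 (proof, §16.4, arXiv:1705.09251v4 p. 51)] -/
theorem card_divisors_lt_of_thm_16_4_of_logBound {θ : ℝ} (hθ : 0 ≤ θ)
    (hsmall : ∀ ε : ℝ, 0 < ε → ∀ ν : ℕ, ∃ K : ℝ, 0 < K ∧ ∀ a b c : ℕ, IsABCTriple a b c →
      (a * b * c).primeFactors.card = ν →
        ((a * b * c).divisors.card : ℝ) ≤ K * (rad a b c : ℝ) ^ (8 / 3 + θ + ε))
    (hlog : ∃ κ : ℝ, ∀ a b c : ℕ, IsABCTriple a b c → Real.log c ≤ κ * (rad a b c : ℝ) ^ θ)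
    (h164 : ∀ ε : ℝ, 0 < ε → ∃ N₀ : ℕ, ∀ (W : WeierstrassCurve ℚ) [W.IsElliptic],
      IsFreyHellegouarch W → N₀ ≤ W.conductorNorm ℤ →
        ∀ D M : ℕ, IsAdmissibleFactorization (W.conductorNorm ℤ) D M →
          2 ≤ (M.primeFactors.erase 2).card →
            ((∏ p ∈ D.primeFactors, (W.minimalDiscriminantNorm ℤ).factorization p : ℕ) : ℝ)
              < (W.conductorNorm ℤ : ℝ) ^ ((8 : ℝ) / 3 + ε) * (M : ℝ))
    (ε : ℝ) (hε : 0 < ε) :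
    ∃ K : ℝ, 0 < K ∧ ∀ a b c : ℕ, IsABCTriple a b c →
      ((a * b * c).divisors.card : ℝ) < K * (rad a b c : ℝ) ^ (8 / 3 + θ + ε) := by
  obtain ⟨κ, hκ⟩ := hlog
  have hl2 : 0 < Real.log 2 := Real.log_pos (by norm_num)
  have htwo : ∃ C₂ : ℝ, 0 < C₂ ∧ ∀ a b c : ℕ, IsABCTriple a b c →
      (((a * b * c).factorization 2 : ℕ) : ℝ) + 1 ≤ C₂ * (rad a b c : ℝ) ^ (θ + ε / 4) := by
    refine ⟨3 * max κ 0 / Real.log 2 + 1, by positivity, fun a b c h => ?_⟩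
    obtain ⟨ha, hb, habc, hcop⟩ := id h
    have hc : 0 < c := by omega
    have h0 := h.mul_ne_zero
    have hR1 : (1 : ℝ) ≤ (rad a b c : ℝ) := one_le_rad_real a b c
    have hRθ : (1 : ℝ) ≤ (rad a b c : ℝ) ^ θ := Real.one_le_rpow hR1 hθ
    have hRθ' : (rad a b c : ℝ) ^ θ ≤ (rad a b c : ℝ) ^ (θ + ε / 4) :=
      Real.rpow_le_rpow_of_exponent_le hR1 (by linarith)
    -- `v₂(abc) log 2 ≤ log(abc) ≤ 3 log c ≤ 3 max(κ,0) rad^θ`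
    have h1 := Literature.Barriers.ABC.factorization_mul_log_two_le Nat.prime_two h0 (q := 2)
    have habc_le : Real.log ((a * b * c : ℕ) : ℝ) ≤ 3 * Real.log c := by
      have hle : ((a * b * c : ℕ) : ℝ) ≤ (c : ℝ) ^ 3 := by
        have : a * b * c ≤ c * c * c :=
          Nat.mul_le_mul (Nat.mul_le_mul (by omega) (by omega)) le_rfl
        calc ((a * b * c : ℕ) : ℝ) ≤ ((c * c * c : ℕ) : ℝ) := by exact_mod_cast this
          _ = (c : ℝ) ^ 3 := by push_cast; ring
      calc Real.log ((a * b * c : ℕ) : ℝ) ≤ Real.log ((c : ℝ) ^ 3) :=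
            Real.log_le_log (by exact_mod_cast Nat.pos_of_ne_zero h0) hle
        _ = 3 * Real.log c := by rw [Real.log_pow]; norm_num
    have hlogc : Real.log c ≤ max κ 0 * (rad a b c : ℝ) ^ θ :=
      (hκ a b c h).trans (mul_le_mul_of_nonneg_right (le_max_left _ _) (by positivity))
    have hv : (((a * b * c).factorization 2 : ℕ) : ℝ) ≤ 3 * max κ 0 / Real.log 2 * (rad a b c : ℝ) ^ θ := by
      rw [div_mul_eq_mul_div, le_div_iff₀ hl2]
      nlinarith [mul_nonneg (le_max_right κ 0) (zero_le_one.trans hRθ)]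
    have hK0 : 0 ≤ 3 * max κ 0 / Real.log 2 + 1 := by positivity
    calc (((a * b * c).factorization 2 : ℕ) : ℝ) + 1
        ≤ 3 * max κ 0 / Real.log 2 * (rad a b c : ℝ) ^ θ + 1 * (rad a b c : ℝ) ^ θ := by
          nlinarith
      _ = (3 * max κ 0 / Real.log 2 + 1) * (rad a b c : ℝ) ^ θ := by ring
      _ ≤ (3 * max κ 0 / Real.log 2 + 1) * (rad a b c : ℝ) ^ (θ + ε / 4) :=
          mul_le_mul_of_nonneg_left hRθ' hK0
  exact card_divisors_lt_of_thm_16_4_core hε (hsmall ε hε) htwo (h164 (ε / 4) (by positivity))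

/-- **Theorem 16.7 from Theorem 16.4 (ii), Proposition 15.1 and the approximation bound**:
`K ≥ 1` with `PastenApproximationBound K` (Pasten, Invent. Math. 2024, Thm 2.1; proved in the tree
from Evertse–Győry 4.2.1) gives Lemma 15.2 (`factorization_two_lt_of_approximationBound`).
[cite: PastenShimura2024, Theorem 16.7 with its proof (§16.4, arXiv:1705.09251v4 p. 51)] -/
theorem pasten2024_thm_2_5_of_thm_16_4 {K : ℝ} (hK : 1 ≤ K) (hP : PastenApproximationBound K)
    (h151 : pastenShimura2024_prop_15_1)
    (h164 : ∀ ε : ℝ, 0 < ε → ∃ N₀ : ℕ, ∀ (W : WeierstrassCurve ℚ) [W.IsElliptic],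
      IsFreyHellegouarch W → N₀ ≤ W.conductorNorm ℤ →
        ∀ D M : ℕ, IsAdmissibleFactorization (W.conductorNorm ℤ) D M →
          2 ≤ (M.primeFactors.erase 2).card →
            ((∏ p ∈ D.primeFactors, (W.minimalDiscriminantNorm ℤ).factorization p : ℕ) : ℝ)
              < (W.conductorNorm ℤ : ℝ) ^ ((8 : ℝ) / 3 + ε) * (M : ℝ)) :
    pasten2024_thm_2_5 :=
  pasten2024_thm_2_5_of_thm_16_4_of_twoAdicBound (factorization_two_lt_of_approximationBound hK hP)
    h151 h164

/-- **The `abc` rung from Theorem 16.4 (ii) with the tree's trust base**: `pasten2024_thm_2_5`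
follows from Theorem 16.4 (ii) (hypothesis `h164`, = `pastenShimura2024_thm_16_4.freyHellegouarch`),
Proposition 15.1 (`pastenShimura2024_prop_15_1`) and Evertse–Győry's Theorem 4.2.1 over `ℚ`
(`Dioph.evertseGyory_thm_4_2_1_rat`, through `pasten2024_thm_2_1`, `K = pastenK`). Residual trust
base of the valuation-product `abc` bound: {Thm 16.4 (ii), Prop 15.1, EG 4.2.1}.
[cite: PastenShimura2024, Theorem 16.7 with its proof (§16.4, arXiv:1705.09251v4 p. 51)]
[cite: EvertseGyory2015, Theorem 4.2.1 (p. 68)] -/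
theorem pasten2024_thm_2_5_of_thm_16_4_of_evertseGyory (hEG : evertseGyory_thm_4_2_1_rat)
    (h151 : pastenShimura2024_prop_15_1)
    (h164 : ∀ ε : ℝ, 0 < ε → ∃ N₀ : ℕ, ∀ (W : WeierstrassCurve ℚ) [W.IsElliptic],
      IsFreyHellegouarch W → N₀ ≤ W.conductorNorm ℤ →
        ∀ D M : ℕ, IsAdmissibleFactorization (W.conductorNorm ℤ) D M →
          2 ≤ (M.primeFactors.erase 2).card →
            ((∏ p ∈ D.primeFactors, (W.minimalDiscriminantNorm ℤ).factorization p : ℕ) : ℝ)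
              < (W.conductorNorm ℤ : ℝ) ^ ((8 : ℝ) / 3 + ε) * (M : ℝ)) :
    pasten2024_thm_2_5 :=
  pasten2024_thm_2_5_of_thm_16_4 one_le_pastenK (pasten2024_thm_2_1 hEG) h151 h164

/-- **The `abc` rung BY NAME from the typed facts**: `pasten2024_thm_2_5` follows from the typed
Theorem 16.4 (`pastenShimura2024_thm_16_4` of `PastenValuationProductsAdmissible.lean`, used
through its case (ii) `.freyHellegouarch`), the typed Proposition 15.1
(`pastenShimura2024_prop_15_1`) and Evertse–Győry 4.2.1 (`Dioph.evertseGyory_thm_4_2_1_rat`).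
This is the kernel form of the trust base of the valuation-product `abc` bound:
{Thm 16.4, Prop 15.1, EG 4.2.1}. [cite: PastenShimura2024, Theorem 16.7 with its proof (§16.4, arXiv:1705.09251v4 p. 51)] -/
theorem pasten2024_thm_2_5_of_pastenShimura2024_thm_16_4 (hEG : evertseGyory_thm_4_2_1_rat)
    (h151 : pastenShimura2024_prop_15_1) (h164 : pastenShimura2024_thm_16_4) :
    pasten2024_thm_2_5 :=
  pasten2024_thm_2_5_of_thm_16_4_of_evertseGyory hEG h151 h164.freyHellegouarch

end Assembly

end Literature.NumberTheory.DiophantineGeometry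

end
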